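import Mathlib
import HarnessLib

/-!
# Evaluating binary forms attached to a polynomial identity (tools for the C4″ bridge)

Solo seat `solo-ABC-blind` (ideation tier, summit-directed), session 6.

For `p ∈ R[X]` and `n ≥ deg p`, Mathlib's `p.homogenize n` is the binary form
`P(X₀, X₁) = X₁ⁿ p(X₀/X₁)`.  This file collects the elementary facts about the integer values
`P(u, v) = MvPolynomial.eval ![u, v] (p.homogenize n)` that the covering bookkeeping of the abc wall
needs (no new definitions):

* `eval_homogenize_eq_sum` — `P(u,v) = Σ_{k+l=n} p_k u^k v^l`;
* `abs_eval_homogenize_le` — `|P(u,v)| ≤ ‖p‖₁ · vⁿ` for `|u| ≤ v`;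
* `cast_eval_homogenize` — compatibility with `ℤ → ℚ`;
* `dvd_eval_homogenize_sub_leadingCoeff` — `v ∣ P(u,v) − p_m u^m` (`m = deg p`), whence
  `eval_homogenize_ne_zero`: `P(u,v) ≠ 0` as soon as `gcd(u,v) = 1` and `v > |p_m|`
  (the rational root theorem in the form used here);
* `homogenize_eq_mul_X_pow`, `homogenize_pow'` and the values of the forms of `X`, `X − 1`, `C d`.

References: folklore; used with Mason 1984 [Mason1984] on the seat's WALL.md (C4″).
-/

noncomputable section

open Polynomial Finset

namespace Summit.ABC.ABC.Theorems

section CommSemiring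

variable {R : Type*} [CommSemiring R]

/-- `P(x₀,x₁) = Σ_{k+l=n} p_k x₀^k x₁^l` for `P = p.homogenize n`. [folklore] -/
theorem eval_homogenize_eq_sum (p : R[X]) (n : ℕ) (x : Fin 2 → R) :
    MvPolynomial.eval x (p.homogenize n) =
      ∑ kl ∈ antidiagonal n, p.coeff kl.1 * x 0 ^ kl.1 * x 1 ^ kl.2 := by
  simp only [Polynomial.homogenize, map_sum]
  refine Finset.sum_congr rfl fun kl _ => ?_
  rw [MvPolynomial.eval_monomial, Finsupp.update_eq_add_single (by simp),
    Finsupp.prod_add_index' (by simp) (by simp [pow_add]), Finsupp.prod_single_index (by simp),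
    Finsupp.prod_single_index (by simp)]
  ring

/-- `p.homogenize m = p.homogenize (deg p) · X₁^{m − deg p}` for `deg p ≤ m`. [folklore] -/
theorem homogenize_eq_mul_X_pow (p : R[X]) {m : ℕ} (h : p.natDegree ≤ m) :
    p.homogenize m = p.homogenize p.natDegree * MvPolynomial.X 1 ^ (m - p.natDegree) := by
  have := Polynomial.homogenize_mul p 1 (le_refl p.natDegree)
    (show (1 : R[X]).natDegree ≤ m - p.natDegree by simp)
  rw [mul_one, Nat.add_sub_cancel' h] at this
  rw [this, Polynomial.homogenize_one]

/-- `(p^e).homogenize (e·m) = (p.homogenize m)^e` for `deg p ≤ m`. [folklore] -/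
theorem homogenize_pow' (p : R[X]) {m : ℕ} (h : p.natDegree ≤ m) (e : ℕ) :
    (p ^ e).homogenize (e * m) = p.homogenize m ^ e := by
  induction e with
  | zero => simp [Polynomial.homogenize_one]
  | succ e ih =>
    rw [pow_succ, Nat.succ_mul, Polynomial.homogenize_mul _ _ ?_ h, ih, pow_succ]
    exact (Polynomial.natDegree_pow_le).trans (Nat.mul_le_mul_left e h)

/-- The form of `X` is `X₀`: value `u`. [folklore] -/
theorem eval_homogenize_X (u v : R) :
    MvPolynomial.eval ![u, v] ((X : R[X]).homogenize 1) = u := by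
  rw [Polynomial.homogenize_X one_ne_zero]; simp

/-- The form of `C d` in degree `m` is `d X₁^m`: value `d v^m`. [folklore] -/
theorem eval_homogenize_C (d : R) (m : ℕ) (u v : R) :
    MvPolynomial.eval ![u, v] ((C d : R[X]).homogenize m) = d * v ^ m := by
  rw [Polynomial.homogenize_C]; simp

end CommSemiring

section CommRing

variable {R : Type*} [CommRing R]

/-- The form of `X − 1` is `X₀ − X₁`: value `u − v`. [folklore] -/
theorem eval_homogenize_X_sub_one (u v : R) :
    MvPolynomial.eval ![u, v] ((X - 1 : R[X]).homogenize 1) = u - v := by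
  rw [Polynomial.homogenize_sub, map_sub, eval_homogenize_X, Polynomial.homogenize_one]; simp

end CommRing

/-! ### Integer values -/

/-- `|P(u,v)| ≤ (Σ_{k≤n} |p_k|) · vⁿ` for `|u| ≤ v`. [folklore] -/
theorem abs_eval_homogenize_le (p : ℤ[X]) (n : ℕ) {u v : ℤ} (hu : |u| ≤ v) :
    |MvPolynomial.eval ![u, v] (p.homogenize n)| ≤ (∑ k ∈ range (n + 1), |p.coeff k|) * v ^ n := by
  have hv : 0 ≤ v := (abs_nonneg u).trans hu
  rw [eval_homogenize_eq_sum, Finset.Nat.sum_antidiagonal_eq_sum_range_succ_mk, Finset.sum_mul]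
  refine (Finset.abs_sum_le_sum_abs _ _).trans (Finset.sum_le_sum fun k hk => ?_)
  have hk : k ≤ n := Nat.lt_succ_iff.mp (Finset.mem_range.mp hk)
  simp only [Matrix.cons_val_zero, Matrix.cons_val_one]
  rw [abs_mul, abs_mul, abs_pow, abs_pow, abs_of_nonneg hv]
  calc |p.coeff k| * |u| ^ k * v ^ (n - k) ≤ |p.coeff k| * v ^ k * v ^ (n - k) := by gcongr
    _ = |p.coeff k| * v ^ n := by rw [mul_assoc, ← pow_add, Nat.add_sub_cancel' hk]

/-- Compatibility of the integer value with the rational one. [folklore] -/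
theorem cast_eval_homogenize (p : ℤ[X]) (n : ℕ) (u v : ℤ) :
    ((MvPolynomial.eval ![u, v] (p.homogenize n) : ℤ) : ℚ) =
      MvPolynomial.eval ![(u : ℚ), (v : ℚ)] ((p.map (Int.castRingHom ℚ)).homogenize n) := by
  rw [eval_homogenize_eq_sum, eval_homogenize_eq_sum]
  push_cast
  simp [Polynomial.coeff_map]

/-- `v ∣ P(u,v) − p_m u^m` where `m = deg p` and `P = p.homogenize m`. [folklore] -/
theorem dvd_eval_homogenize_sub_leadingCoeff (p : ℤ[X]) (u v : ℤ) :
    v ∣ MvPolynomial.eval ![u, v] (p.homogenize p.natDegree) - p.leadingCoeff * u ^ p.natDegree := by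
  rw [eval_homogenize_eq_sum, Finset.Nat.sum_antidiagonal_eq_sum_range_succ_mk,
    Finset.sum_range_succ]
  simp only [Matrix.cons_val_zero, Matrix.cons_val_one, Nat.sub_self, pow_zero, mul_one,
    Polynomial.leadingCoeff, add_sub_cancel_right]
  refine Finset.dvd_sum fun k hk => ?_
  have hk : k < p.natDegree := Finset.mem_range.mp hk
  obtain ⟨j, hj⟩ : ∃ j, p.natDegree - k = j + 1 := ⟨p.natDegree - k - 1, by omega⟩
  rw [hj, pow_succ]
  exact Dvd.intro_left (p.coeff k * u ^ k * v ^ j) (by ring)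

/-- **Rational root theorem, form version.**  If `gcd(u, v) = 1` and `v > |p_m|` (`p ≠ 0`,
`m = deg p`) then `P(u,v) ≠ 0`. [folklore] -/
theorem eval_homogenize_ne_zero {p : ℤ[X]} (hp : p ≠ 0) {u v : ℤ} (hcop : IsCoprime u v)
    (hv : |p.leadingCoeff| < v) :
    MvPolynomial.eval ![u, v] (p.homogenize p.natDegree) ≠ 0 := by
  intro h0
  have hdvd := dvd_eval_homogenize_sub_leadingCoeff p u v
  rw [h0, zero_sub, dvd_neg] at hdvd
  have h1 : v ∣ p.leadingCoeff := by
    have := (IsCoprime.pow_right (n := p.natDegree) hcop.symm)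
    exact this.dvd_of_dvd_mul_right hdvd
  have hlc : p.leadingCoeff ≠ 0 := leadingCoeff_ne_zero.mpr hp
  have h2 := Int.le_of_dvd (abs_pos.mpr hlc) ((dvd_abs _ _).mpr h1)
  omega

/-- Same at any degree `m ≥ deg p`: `P_m(u,v) = P(u,v) · v^{m − deg p} ≠ 0` if moreover `v ≠ 0`.
[folklore] -/
theorem eval_homogenize_ne_zero' {p : ℤ[X]} (hp : p ≠ 0) {m : ℕ} (hm : p.natDegree ≤ m) {u v : ℤ}
    (hcop : IsCoprime u v) (hv : |p.leadingCoeff| < v) :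
    MvPolynomial.eval ![u, v] (p.homogenize m) ≠ 0 := by
  have hv0 : v ≠ 0 := by
    have := abs_nonneg p.leadingCoeff; omega
  rw [homogenize_eq_mul_X_pow p hm, map_mul, map_pow]
  simp only [MvPolynomial.eval_X, Matrix.cons_val_one]
  exact mul_ne_zero (eval_homogenize_ne_zero hp hcop hv) (pow_ne_zero _ hv0)

end Summit.ABC.ABC.Theorems

end
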